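import Mathlib
import Summits.ValiantsHypothesis.ValiantsHypothesis.Theses.BarrierLever
import Summits.ValiantsHypothesis.ValiantsHypothesis.Theorems.BarrierLeverPrincipalMinorLayoutsNonsingularRefutation
import Summits.ValiantsHypothesis.ValiantsHypothesis.Theorems.BarrierLeverTransversalSufficesForPrincipal
import Summits.ValiantsHypothesis.ValiantsHypothesis.Theorems.BarrierLeverTransversalMinorLayoutsNonsingularOfTropicalDet

/-!
# Route BarrierLever — item `TropicalDetCertificatesExist` (stmt-ValiantsHypothesis-19316): REFUTATION

Refutation file (`--workitem stmt-ValiantsHypothesis-19316`; cell valiant-natproofs, rung V4, 𝒟-side;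
prover seat val-np-p3 gen 4). Definition-free; a corollary of the refutation of TNS
(`TNSRefutation.not_PrincipalMinorLayoutsNonsingular`, item 19126: at `h = 31` the layout
`u = (∅, {0}, …, {30})`, `w =` all subsets of `{0,…,4}` has a singular principal-minor layout
matrix for EVERY `K`) through arrows already in the tree.

**`not_TropicalDetCertificatesExist`**: unique-tropical-determinant (UT-D) certificates do NOT exist for every
layout, since they imply TT (`TropicalDet.transversalMinorLayoutsNonsingular_of_tropicalDetCertificates`, built on
item 19315), TT ⇒ TNS (19153), and TNS is false.

WHAT THIS IS NOT: item 19717 `PartitionMinorsHitByVP` (layout-dependent witnesses) is untouched;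
nothing on crux stmt-14610 or `VP` vs `VNP`.
-/

set_option linter.dupNamespace false

namespace Summit.ValiantsHypothesis.ValiantsHypothesis.Theorems.BarrierLever.TNSRefutation

/-- **UT-D certificates do not always exist** (item `TropicalDetCertificatesExist`,
stmt-ValiantsHypothesis-19316): by the tree arrow UT-D ⇒ TT
(`TropicalDet.transversalMinorLayoutsNonsingular_of_tropicalDetCertificates`), TT ⇒ TNS (19153) and the
refutation of TNS. -/
theorem not_TropicalDetCertificatesExist :
    ¬ Summit.ValiantsHypothesis.ValiantsHypothesis.Theses.BarrierLever.TropicalDetCertificatesExist :=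
  fun hU => not_PrincipalMinorLayoutsNonsingular
    (TransversalDictionary.transversalSufficesForPrincipal
      (TropicalDet.transversalMinorLayoutsNonsingular_of_tropicalDetCertificates hU))

end Summit.ValiantsHypothesis.ValiantsHypothesis.Theorems.BarrierLever.TNSRefutation
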